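import Summits.CriticalPhenomena.PercolationContinuityZ3.Theorems.Transplant.BoxProdZ2AllFibres
import Summits.CriticalPhenomena.PercolationContinuityZ3.Theorems.Transplant.BoxProdZ2ConcCorollaries
import Summits.CriticalPhenomena.PercolationContinuityZ3.Theorems.Transplant.SlabProdIso
import Mathlib.Combinatorics.SimpleGraph.Prod
import HarnessLib

/-!
# `ℤ² × F` at its OWN critical point for every finite connected `F` (target `ZdTimesFiniteOwnCriticalContinuity 2` of
# `StatementLattices`), hence `ZdTimesFiniteOwnCriticalContinuity d` for EVERY `d ≥ 2`; the slab theorem `SlabOwnCriticalContinuity 3`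
# (Duminil-Copin–Sidoravicius–Tassion) re-derived by Kozma–Nitzan's method as a regression

builds on p205010 (kernel theorem, internal audit signed; external expert review pending).
Status sentence (coordinator 2026-08-20T04:30Z): "θ(p_c) = 0 on ℤ^d, all d ≥ 2 — kernel-verified (Lean 4/Mathlib, standard axioms); internal adversarial
audit SIGNED 2026-08-20 04:29Z; external expert review pending."
Lane `prim-bschramm-*`, seat `prim-bschramm-p2` (gen 3; class C1b, METHOD = input substitution); helper file (`--supports stmt-CriticalPhenomena-4575`).

The tree's `zdTimesFiniteOwnCriticalContinuity_holds (d) (hd : 3 ≤ d)` (stmt-g6, `BoxProdZ2ConcCorollaries`, p228822) stops at `d = 3` because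
the product node `BSConj4_boxProdZ2` asks for an INFINITE fibre `X = ℤ^{d-2} □ F`.  The cardinality-free node
`BoxProdZ2.bsConj4_boxProdZ2_all` (`BoxProdZ2AllFibres`, p229671: `Infinite W` was idle) supplies the missing `d = 2`:
* **`zdTimesFiniteOwnCriticalContinuity_two : ZdTimesFiniteOwnCriticalContinuity 2`** — `θ_{ℤ² □ F}((0,w), p_c(ℤ² □ F)) = 0` for every finite
  connected `F` and every `w` (commute the factors with Mathlib's `boxProdComm`, transport `θ`/`p_c` by `theta_iso`/`criticalProb_iso`);
* **`zdTimesFiniteOwnCriticalContinuity_of_two_le (d) (hd : 2 ≤ d)`** — all `d ≥ 2` (`d = 2` here, `d ≥ 3` p228822);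
* regression `example : SlabOwnCriticalContinuity 3` through `slabOwnCriticalContinuity_of_zdTimesFinite` (p2's `slabProdIso`, p208753): the
  Duminil-Copin–Sidoravicius–Tassion theorem `θ_{ℤ²×{0,…,k}}(p_c) = 0` — in the tree since `DuminilCopinSidoraviciusTassion2016_holds` by the
  planar proof — obtained a second time, by Kozma–Nitzan's renormalisation + near-one gluing (the two proofs share no percolation estimate
  beyond Burton–Keane uniqueness and `p_c(ℤ²) < 1`).
[cite: DuminilCopinSidoraviciusTassion2016, Thm. 1 and p. 3 (remark "ℤ² × G, G finite")] [cite: KozmaNitzan2024, §4 Theorem 6 ("for ℤ^d for any d ≥ 2")]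
[cite: BenjaminiSchramm1996, Conj. 4] [cite: MartineauPanagiotis2025, Prop. 1.10]
-/

noncomputable section

namespace Summit.CriticalPhenomena.PercolationContinuityZ3.Theorems

namespace Transplant

open MeasureTheory Literature.Probability.Percolation Literature.Probability.LatticeModels SimpleGraph
open Literature.Barriers.CriticalPhenomena (IsQuasiTransitive)

/-- **`ℤ² × F` at its own critical point, every finite connected `F`** (`ZdTimesFiniteOwnCriticalContinuity 2`): the cardinality-free product
theorem `BoxProdZ2.bsConj4_boxProdZ2_all` at `X = F` (finite graphs are quasi-transitive), transported along `boxProdComm : ℤ² □ F ≃g F □ ℤ²`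
(`(0, w) ↦ (w, 0)`) — builds on p205010 (kernel theorem, internal audit signed; external expert review pending).
[cite: DuminilCopinSidoraviciusTassion2016, p. 3 (remark "ℤ² × G, G finite")] [cite: KozmaNitzan2024, §4 Theorem 6] -/
theorem zdTimesFiniteOwnCriticalContinuity_two : ZdTimesFiniteOwnCriticalContinuity 2 := by
  intro W _ F hF w
  classical
  -- the product theorem at `X = F`, root `(w, 0)`
  have hX := BoxProdZ2.bsConj4_boxProdZ2_all F hF (BoxProdZ2.isQuasiTransitive_of_finite F) w
  -- commute the factors
  set e : (zdGraph 2 □ F) ≃g (F □ zdGraph 2) := SimpleGraph.boxProdComm (zdGraph 2) F with he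
  have he0 : e ((0 : Site 2), w) = (w, (0 : Site 2)) := rfl
  have hθ : ∀ p, theta (F □ zdGraph 2) (e ((0 : Site 2), w)) p = theta (zdGraph 2 □ F) ((0 : Site 2), w) p :=
    fun p => theta_iso e _ p
  have hpc : criticalProbIOf (zdGraph 2 □ F) ((0 : Site 2), w) = criticalProbIOf (F □ zdGraph 2) (e ((0 : Site 2), w)) :=
    Subtype.ext (criticalProb_iso e _).symm
  rw [← hθ, hpc, he0]
  exact hX

/-- **`ℤ^d × F` at its own critical point for EVERY `d ≥ 2` and every finite connected `F`** (`d = 2`: `zdTimesFiniteOwnCriticalContinuity_two`;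
`d ≥ 3`: stmt-g6's `zdTimesFiniteOwnCriticalContinuity_holds` from the product node) — builds on p205010 (kernel theorem, internal audit signed;
external expert review pending). [cite: BenjaminiSchramm1996, Conj. 4] [cite: MartineauPanagiotis2025, Prop. 1.10] -/
theorem zdTimesFiniteOwnCriticalContinuity_of_two_le (d : ℕ) (hd : 2 ≤ d) : ZdTimesFiniteOwnCriticalContinuity d := by
  rcases Nat.lt_or_ge d 3 with h | h
  · obtain rfl : d = 2 := by omega
    exact zdTimesFiniteOwnCriticalContinuity_two
  · exact zdTimesFiniteOwnCriticalContinuity_holds d h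

-- Regression: the slab theorem of Duminil-Copin–Sidoravicius–Tassion (`SlabOwnCriticalContinuity 3`, in the tree as `slabOwnCriticalContinuity_three`
-- from `DuminilCopinSidoraviciusTassion2016_holds`) a SECOND time, by Kozma–Nitzan's method: `S_k ≅ ℤ² □ P_{k+1}` (`slabProdIso`) and the `d = 2`
-- product theorem above.
example : SlabOwnCriticalContinuity 3 :=
  slabOwnCriticalContinuity_of_zdTimesFinite zdTimesFiniteOwnCriticalContinuity_two

end Transplant

end Summit.CriticalPhenomena.PercolationContinuityZ3.Theorems

end
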